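import Mathlib
import HarnessLib

/-!
# Linear forms `Σ_l a_l X_l` in a polynomial ring: coefficients, homogeneity, linear independence

Topic: `Literature/RingTheory/MvPolynomial` (tree library; cell `res-hironaka`, librarian res-D-lib-2, DEDUPE HOIST). The four
lemmas below, in the «explicit sum» shape `∑ l, a l • X l` and for ANY commutative (semi)ring of coefficients and any finite
index type, were re-proved PRIVATELY in six files of the HIRONAKA lane (`Hironaka2017/Proofs/S04CharAlgebra/{EdgeDatumOfLifts,
EdgeDatumOfLiftsParams, EdgeDatumQuadric, Rem4p10i, Rem4p10k}`, `…/S07Permissible/{U36L45InstE, Thm7p23aRational}`: edge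
parameters of Def 4.8 / Eq (27) are linear forms in the edge variables). For a FIELD and `Fin n` the bundled version is
`Literature.RingTheory.MvPolynomial.Directrix.linForm` (`linForm_apply`, `linForm_injective`, `range_linForm`,
`isHomogeneous_linForm`); this file is the unbundled, ring-general companion:

* `coeff_single_one_sum_smul_X` — `coeff (single k 1) (Σ a_l X_l) = a_k`;
* `isHomogeneous_one_sum_smul_X` — `Σ a_l X_l` is homogeneous of degree `1`;
* `eq_sum_coeff_single_one_smul_X` — a form of degree `1` IS `Σ_k coeff (single k 1) ℓ • X_k`;
* `sum_smul_X_injective`, `sum_smul_X_eq_zero_iff` — the coefficient vector is determined;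
* `linearIndependent_sum_smul_X_iff` — linear forms are independent iff their coefficient vectors are (any commutative ring).

## References
* S. Lang, *Algebra*, rev. 3rd ed., GTM 211 (2002), Ch. II §3 (polynomials: the monomials form a basis of `A[X]` over `A`) —
  the linear-algebra fact these lemmas unfold for the degree-one monomials `X_l`. [Lang2002]
-/

open MvPolynomial

namespace Literature.RingTheory.MvPolynomial

universe u v

variable {σ : Type u} [Fintype σ] {R : Type v} [CommSemiring R]

/-- `coeff (single k 1) (Σ_l a_l • X_l) = a_k`. [cite: Lang2002, Ch. II §3 (A[X] is free on the monomials; forms of degree one)] -/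
theorem coeff_single_one_sum_smul_X [DecidableEq σ] (a : σ → R) (k : σ) :
    coeff (Finsupp.single k 1) (∑ l, a l • (X l : MvPolynomial σ R)) = a k := by
  rw [coeff_sum]
  simp only [coeff_smul, coeff_X, smul_eq_mul, mul_ite, mul_one, mul_zero]
  rw [Finset.sum_eq_single k]
  · rw [if_pos rfl]
  · intro w _ hwk
    rw [if_neg]
    intro h
    exact hwk ((Finsupp.single_left_inj one_ne_zero).mp h)
  · intro h
    exact absurd (Finset.mem_univ k) h

/-- Linear forms `Σ_l a_l • X_l` are homogeneous of degree `1`. [cite: Lang2002, Ch. II §3 (A[X] is free on the monomials; forms of degree one)] -/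
theorem isHomogeneous_one_sum_smul_X (a : σ → R) :
    (∑ l, a l • (X l : MvPolynomial σ R)).IsHomogeneous 1 := by
  refine IsHomogeneous.sum _ _ _ fun l _ => ?_
  rw [smul_eq_C_mul]
  exact isHomogeneous_C_mul_X (a l) l

/-- A form of degree `1` is the linear form on its `X_k`-coefficients: `ℓ = Σ_k coeff (single k 1) ℓ • X_k`.
[cite: Lang2002, Ch. II §3 (A[X] is free on the monomials; forms of degree one)] -/
theorem eq_sum_coeff_single_one_smul_X [DecidableEq σ] {ℓ : MvPolynomial σ R} (hℓ : ℓ.IsHomogeneous 1) :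
    ℓ = ∑ k, coeff (Finsupp.single k 1) ℓ • (X k : MvPolynomial σ R) := by
  refine MvPolynomial.ext _ _ fun d => ?_
  rw [coeff_sum]
  simp only [coeff_smul, coeff_X, smul_eq_mul, mul_ite, mul_one, mul_zero]
  by_cases hd : ∃ v, Finsupp.single v 1 = d
  · obtain ⟨v, rfl⟩ := hd
    rw [Finset.sum_eq_single v]
    · rw [if_pos rfl]
    · intro w _ hwv
      rw [if_neg]
      intro h
      exact hwv ((Finsupp.single_left_inj one_ne_zero).mp h)
    · intro h
      exact absurd (Finset.mem_univ v) h
  · rw [Finset.sum_eq_zero fun v _ => if_neg fun h => hd ⟨v, h⟩]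
    by_contra hne
    have hdeg : d.degree = 1 := by
      by_contra hdeg
      exact hne (hℓ.coeff_eq_zero hdeg)
    apply hd
    -- a finsupp of degree one is a `single v 1`
    have hsupp : d.support.Nonempty := by
      rw [Finset.nonempty_iff_ne_empty]
      intro hemp
      have : d = 0 := Finsupp.support_eq_empty.mp hemp
      rw [this, map_zero] at hdeg
      exact zero_ne_one hdeg
    obtain ⟨v, hv⟩ := hsupp
    refine ⟨v, ?_⟩
    have hv1 : d v = 1 := by
      have hle : d v ≤ 1 := by
        rw [← hdeg, Finsupp.degree_apply]
        exact Finset.single_le_sum (fun _ _ => Nat.zero_le _) hv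
      have hpos : 0 < d v := Nat.pos_of_ne_zero (Finsupp.mem_support_iff.mp hv)
      omega
    ext w
    by_cases hw : w = v
    · subst hw; rw [Finsupp.single_eq_same, hv1]
    · rw [Finsupp.single_eq_of_ne hw]
      by_contra hne0
      have hwmem : w ∈ d.support := Finsupp.mem_support_iff.mpr (Ne.symm hne0)
      have h2 : d v + d w ≤ d.degree := by
        rw [Finsupp.degree_apply]
        exact Finset.add_le_sum (fun _ _ => Nat.zero_le _) hv hwmem (Ne.symm hw)
      rw [hdeg, hv1] at h2
      have : 0 < d w := Nat.pos_of_ne_zero (Ne.symm hne0)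
      omega

/-- The coefficient vector of a linear form is determined: `a ↦ Σ_l a_l • X_l` is injective.
[cite: Lang2002, Ch. II §3 (A[X] is free on the monomials; forms of degree one)] -/
theorem sum_smul_X_injective :
    Function.Injective fun a : σ → R => ∑ l, a l • (X l : MvPolynomial σ R) := by
  classical
  intro a b h
  funext k
  have := congrArg (coeff (Finsupp.single k 1)) h
  simpa only [coeff_single_one_sum_smul_X] using this

/-- `Σ_l a_l • X_l = 0 ↔ a = 0`. [cite: Lang2002, Ch. II §3 (A[X] is free on the monomials; forms of degree one)] -/
theorem sum_smul_X_eq_zero_iff (a : σ → R) : ∑ l, a l • (X l : MvPolynomial σ R) = 0 ↔ a = 0 := by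
  constructor
  · intro h
    exact sum_smul_X_injective (h.trans (by simp : (∑ l, (0 : σ → R) l • (X l : MvPolynomial σ R)) = 0).symm)
  · rintro rfl; simp

end Literature.RingTheory.MvPolynomial

namespace Literature.RingTheory.MvPolynomial

universe u v

variable {σ : Type u} [Fintype σ] {R : Type v} [CommRing R]

/-- **Linear forms are linearly independent iff their coefficient vectors are** (any commutative ring of coefficients):
for `a : ι → σ → R`, the family `j ↦ Σ_l a j l • X_l` is `R`-linearly independent iff `a` is.
[cite: Lang2002, Ch. II §3 (A[X] is free on the monomials; forms of degree one)] -/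
theorem linearIndependent_sum_smul_X_iff {ι : Type*} (a : ι → σ → R) :
    LinearIndependent R (fun j => ∑ l, a j l • (X l : MvPolynomial σ R)) ↔ LinearIndependent R a := by
  classical
  -- the linear map `a ↦ Σ a_l X_l` has trivial kernel
  let L : (σ → R) →ₗ[R] MvPolynomial σ R :=
    { toFun := fun a => ∑ l, a l • (X l : MvPolynomial σ R)
      map_add' := fun a b => by simp [add_smul, Finset.sum_add_distrib]
      map_smul' := fun c a => by simp [Finset.smul_sum, smul_smul] }
  have hker : LinearMap.ker L = ⊥ :=
    LinearMap.ker_eq_bot.mpr (sum_smul_X_injective (σ := σ) (R := R))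
  have : (fun j => ∑ l, a j l • (X l : MvPolynomial σ R)) = L ∘ a := rfl
  rw [this]
  exact LinearMap.linearIndependent_iff L hker

end Literature.RingTheory.MvPolynomial
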